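import Literature.Probability.RandomPlanarGeometry.ConformalMapRiemannProofs
import Literature.Probability.RandomPlanarGeometry.ConformalMapCaratheodoryProofs
import Literature.Probability.RandomPlanarGeometry.JordanDomainProofs
import HarnessLib

/-!
# The Carathéodory boundary chart at a marked boundary point of a Jordan domain
— UBHP brick of line `symplectic-fermion-anchor`
(crux `SAWLoopFugacityFlow.AvoidanceLimit`, stmt-CriticalPhenomena-10649)

The uniform boundary Harnack principle `stub_uniformBHP` of the line is proved in the Carathéodory
boundary chart at a boundary point `p ∈ ∂D` of a Jordan domain `D`: a Riemann map `φ : 𝔻 → D`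
(`exists_conformalEquiv_ball_holds`, Jordan domains being simply connected,
`JordanDomain.isSimplyConnected_holds`), extended by Carathéodory's theorem
(`JordanDomain.exists_continuousOn_extension_holds`) to a continuous bijection `Ψ` of the closed disc
onto `closure D` taking the unit circle onto `∂D`, and the preimage `ζ = Ψ⁻¹ p` on the circle.

* `exists_boundaryChart_invUniformContinuous` (registered signature) packages this chart together with
  the one item that is not a field of the named facts: the inverse `Ψ⁻¹` is uniformly continuous on
  `closure D` ("Euclidean-close in `D̄` forces close in the disc"), because `Ψ` is a continuous
  injection on the COMPACT closed disc (`forall_dist_lt_of_isCompact_injOn`: on the compact set of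
  `ε`-separated pairs the continuous positive function `dist (Ψ x) (Ψ y)` is bounded below).

Sources: folklore (compactness); the two named facts are Ahlfors (1979) Ch. 6 §1.1 Thm. 1 and
Pommerenke (1992) Thm. 2.6, both proved in the tree. No definitions.
-/

noncomputable section

open scoped Topology
open Literature.Probability.RandomPlanarGeometry

namespace Summit.CriticalPhenomena.SAWScalingLimit.Theorems.AvoidanceLimit.Anchor

/-- **A continuous injection on a compact set has a uniformly continuous inverse**: if `Ψ` is
continuous and injective on the compact set `K ⊆ ℂ`, then for every `ε > 0` there is `m > 0` such that
`dist (Ψ x) (Ψ y) < m` forces `dist x y < ε` for `x, y ∈ K`. Proof: the set of pairs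
`(x, y) ∈ K × K` with `ε ≤ dist x y` is compact, and on it `dist (Ψ x) (Ψ y)` is continuous and
positive, hence bounded below by a positive constant. [folklore] -/
theorem forall_dist_lt_of_isCompact_injOn {K : Set ℂ} (hK : IsCompact K) {Ψ : ℂ → ℂ}
    (hc : ContinuousOn Ψ K) (hi : Set.InjOn Ψ K) {ε : ℝ} (hε : 0 < ε) :
    ∃ m : ℝ, 0 < m ∧ ∀ x ∈ K, ∀ y ∈ K, dist (Ψ x) (Ψ y) < m → dist x y < ε := by
  -- the compact set of `ε`-separated pairs of `K`
  set S : Set (ℂ × ℂ) := (K ×ˢ K) ∩ {q | ε ≤ dist q.1 q.2}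
  have hSc : IsCompact S :=
    (hK.prod hK).inter_right (isClosed_le continuous_const continuous_dist)
  have hg : ContinuousOn (fun q : ℂ × ℂ => dist (Ψ q.1) (Ψ q.2)) S :=
    continuous_dist.comp_continuousOn
      ((hc.comp continuous_fst.continuousOn fun q hq => hq.1.1).prodMk
        (hc.comp continuous_snd.continuousOn fun q hq => hq.1.2))
  have hpos : ∀ q ∈ S, (0 : ℝ) < dist (Ψ q.1) (Ψ q.2) := by
    rintro ⟨x, y⟩ ⟨⟨hx, hy⟩, hxy⟩
    refine dist_pos.2 fun h => ?_
    have hxy' : x = y := hi hx hy h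
    subst hxy'
    have h0 : ε ≤ dist x x := hxy
    rw [dist_self] at h0
    exact absurd h0 (not_le.2 hε)
  obtain ⟨m, hm, hmS⟩ := hSc.exists_forall_le' hg hpos
  refine ⟨m, hm, fun x hx y hy hlt => ?_⟩
  by_contra h
  exact absurd hlt (not_lt.2 (hmS (x, y) ⟨⟨hx, hy⟩, not_lt.1 h⟩))

/-- **The Carathéodory boundary chart at a marked boundary point, with uniformly continuous
inverse.** For a Jordan domain `D` and `p ∈ ∂D` there are a conformal equivalence `φ : 𝔻 → D`
(Riemann mapping theorem, `exists_conformalEquiv_ball_holds`; `D` is simply connected,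
`JordanDomain.isSimplyConnected_holds`), its Carathéodory extension `Ψ` — continuous on the closed
disc, equal to `φ` on `𝔻`, a bijection of the closed disc onto `closure D` and of the unit circle onto
`∂D` (`JordanDomain.exists_continuousOn_extension_holds`) — and a point `ζ` of the unit circle with
`Ψ ζ = p`; moreover `Ψ⁻¹` is uniformly continuous on `closure D`: for every `ε > 0` some `m > 0` has
`dist (Ψ x) (Ψ y) < m → dist x y < ε` on the closed disc (a continuous injection on a compact set,
`forall_dist_lt_of_isCompact_injOn`). [folklore] -/
theorem exists_boundaryChart_invUniformContinuous :
    ∀ (D : JordanDomain) (p : ℂ), p ∈ frontier D.carrier →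
      ∃ (φ : ConformalEquiv (Metric.ball (0 : ℂ) 1) D.carrier) (Ψ : ℂ → ℂ) (ζ : ℂ),
        ‖ζ‖ = 1 ∧ Ψ ζ = p ∧ ContinuousOn Ψ (Metric.closedBall 0 1) ∧ Set.EqOn Ψ φ (Metric.ball 0 1) ∧
        Set.BijOn Ψ (Metric.closedBall 0 1) (closure D.carrier) ∧
        Set.BijOn Ψ (Metric.sphere 0 1) (frontier D.carrier) ∧
        (∀ ε : ℝ, 0 < ε → ∃ m : ℝ, 0 < m ∧ ∀ x ∈ Metric.closedBall (0 : ℂ) 1,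
          ∀ y ∈ Metric.closedBall (0 : ℂ) 1, dist (Ψ x) (Ψ y) < m → dist x y < ε) := by
  intro D p hp
  obtain ⟨φ⟩ :=
    exists_conformalEquiv_ball_holds D.isOpen D.isSimplyConnected_holds D.carrier_ne_univ
  obtain ⟨Ψ, hcont, heq, hbij, hsph⟩ :=
    JordanDomain.exists_continuousOn_extension_holds D φ.symm
  obtain ⟨ζ, hζ, hζp⟩ := hsph.surjOn hp
  exact ⟨φ.symm, Ψ, ζ, mem_sphere_zero_iff_norm.1 hζ, hζp, hcont, heq, hbij, hsph,
    fun ε hε => forall_dist_lt_of_isCompact_injOn (isCompact_closedBall 0 1) hcont hbij.injOn hε⟩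

end Summit.CriticalPhenomena.SAWScalingLimit.Theorems.AvoidanceLimit.Anchor

end
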